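import Summits.ResolutionOfSingularities.ResolutionOfSingularities.Theorems.FrobeniusClosingDefs

/-!
# Route `FrobeniusClosing` — the cascade below the target: `BoundedMilnor` and `ClosingReduction`
# follow from `IsolatedForcedTermination`

Route `ResolutionOfSingularities/FrobeniusClosing` derives its target `IsolatedForcedTermination`
(stmt-ResolutionOfSingularities-16343) as `ClosingReduction NoPeriodicIsolatedAtom BoundedMilnor`. The
rescue chain W4.1 closes the target the other way round — through the sibling route `WildCones`'
`ClassicalRegimes` (p = 2 Milnor descent) and the landed engine
`Theorems.WildCones.frobeniusClosing_isolatedForcedTermination_of_classicalRegimes` — so the two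
lower cruxes become COROLLARIES of the target:

* `boundedMilnor_of_isolatedForcedTermination` — `BoundedMilnor` (stmt-16346: "μ is bounded along
  every infinite isolated multiplicity-`p` run") is VACUOUSLY implied by the target ("there is no
  infinite isolated multiplicity-`p` run"): its hypothesis is literally the negation of the target's
  conclusion (same binders, same `let`-bound coefficient calculus);
* `closingReduction_of_isolatedForcedTermination` — `ClosingReduction` (stmt-16347) is by definition
  `NoPeriodicIsolatedAtom → BoundedMilnor → IsolatedForcedTermination`, so the target gives it by
  discarding the two hypotheses.

The closers `BoundedMilnor`/`ClosingReduction` by name follow in their own files the moment the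
target's proof `IsolatedForcedTermination` lands (chain W4.1, `L/w41/CHAIN.md` v1, cascade F5 → F7).
No mathematics beyond bookkeeping; both observations are recorded in the 2026-08-17 crux-attack notes
of the two items (`Cruxes/BoundedMilnor/Disproof.lean`, vacuity structure). [folklore]
-/

noncomputable section

-- single-problem summit: the doubled namespace component `ResolutionOfSingularities` is forced
set_option linter.dupNamespace false

open Summit.ResolutionOfSingularities.ResolutionOfSingularities.Theses.FrobeniusClosing
  (IsolatedForcedTermination BoundedMilnor ClosingReduction NoPeriodicIsolatedAtom)

namespace Summit.ResolutionOfSingularities.ResolutionOfSingularities.Theorems.FrobeniusClosing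

/-- **`IsolatedForcedTermination → BoundedMilnor`** (vacuously): the crux `BoundedMilnor` bounds
`μ` along every infinite isolated multiplicity-`p` run, and the target says there is none.
[folklore] -/
theorem boundedMilnor_of_isolatedForcedTermination (hT : IsolatedForcedTermination) :
    BoundedMilnor := by
  rw [boundedMilnor_iff]
  rw [isolatedForcedTermination_iff] at hT
  intro p hp n hn κ _ _ _ c₀ i t hall
  exact absurd hall (hT p hp n hn κ c₀ i t)

/-- **`IsolatedForcedTermination → ClosingReduction`**: `ClosingReduction` is by definition
`NoPeriodicIsolatedAtom → BoundedMilnor → IsolatedForcedTermination`. [folklore] -/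
theorem closingReduction_of_isolatedForcedTermination (hT : IsolatedForcedTermination) :
    ClosingReduction :=
  fun _ _ => hT

end Summit.ResolutionOfSingularities.ResolutionOfSingularities.Theorems.FrobeniusClosing

end
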